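import Literature.AlgebraicGeometry.Frobenioids.PsiBaseTransport
import Literature.AlgebraicGeometry.Frobenioids.DivisorMonoidCategoryTheoreticityCorProofsV
import HarnessLib

/-!
# Frobenioids I, Theorem 3.4 (v): `Ψ^Base` is an equivalence; the `1`-unique square and its rigidity

Mochizuki, *The geometry of Frobenioids I: the general theory*, Kyushu J. Math. **62** (2008)
293–400, Thm. 3.4 (v) p. 63 ll. 25–37, proof p. 69 ll. 1–27 [cite: MochizukiFrdI2008, Thm. 3.4 (v) p.63]:

> "… it follows that we obtain an equivalence of categories … that is 1-compatible with `Ψ` …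
> This completes the proof of assertion (v)." / "Finally, if `D_1`, `D_2` are slim, then each of the
> composite functors of this diagram is rigid."

PROOF file (seat abc-iut-L1-d4 gen 2; sub-nodes FrdI:Thm3.4(v)/L13 `PsiBaseFunctor`, L14 `BaseRigidity` and
the glue of the assembly L00 of plan/L1/SUBDAG-FrdI-Thm34.md), on top of the construction
`PsiBaseTransport.psiBase` / `psiBaseSquare`:
* `nonempty_psiBase_comp_iso_id(')` — `Ψ^Base ⋙ (Ψ⁻¹)^Base ≅ 𝟭` and its mirror: paste the two squares
  with the unit / counit of `Ψ` (`Base₁ ⋙ (Ψ^Base ⋙ (Ψ⁻¹)^Base) ≅ Base₁ ⋙ 𝟭`) and descend;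
* `psiBase_isEquivalence` — **`Ψ^Base` is an equivalence**: whiskering with `Base₁` reflects isomorphy of
  functors out of `D₁` (abc-iut-L1-d6's `nonempty_iso_of_iso_whisker_base`, Def. 1.3 (i)(a)(b)(c)), so the
  two composites are isomorphic to identities;
* `exists_oneUniqueSquare_base` — **the third conjunct of the typed [FrdI] Thm. 3.4 (v)**
  (abc-iut-L1-t3's `PreFrobenioidData.Thm34v`): `∃ Ψ^Base, OneUniqueSquare Ψ Base₁ Base₂ Ψ^Base ∧` both
  composites rigid — `1`-uniqueness by abc-iut-L1-d6's `oneUniqueSquare_base_of_oneCommutes`, rigidity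
  by Prop. 1.13 (i) (abc-iut-L1-t1's `isRigidFunctor_baseFunctor`, `D₂` slim).
INPUTS BY NAME (not restated, not proved here): `hbi`/`hbi'` — `Ψ`, `Ψ⁻¹` carry pre-steps to morphisms
with invertible base (Thm. 3.4 (iii): base-isomorphisms are preserved); `hbe`/`hbe'` — `Ψ`, `Ψ⁻¹`
preserve base-equivalent pairs (Thm. 3.4 (v), first sentence = sub-node L12).
-/

-- `(PreFrobenioidData.ofFunctor Φ F).base` is `baseFunctor F` only at default transparency.
set_option backward.isDefEq.respectTransparency false

namespace Literature.AlgebraicGeometry.Frobenioids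

open CategoryTheory Opposite

universe w v v' u u'

namespace PreFrobenioid

variable {D₁ : Type u} [Category.{v} D₁] {Φ₁ : D₁ᵒᵖ ⥤ CommMonCat.{w}} {C₁ : Type u'} [Category.{v'} C₁]
  {D₂ : Type u} [Category.{v} D₂] {Φ₂ : D₂ᵒᵖ ⥤ CommMonCat.{w}} {C₂ : Type u'} [Category.{v'} C₂]
  {F₁ : C₁ ⥤ ElemFrobenioid Φ₁} {F₂ : C₂ ⥤ ElemFrobenioid Φ₂}
  (hF₁ : IsFrobenioid F₁) (hF₂ : IsFrobenioid F₂) (Ψ : C₁ ≌ C₂)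
  (hbi : ∀ ⦃B A : C₁⦄ (α : B ⟶ A), IsPreStep F₁ α → IsIso (Base F₂ (Ψ.functor.map α)))
  (hbe : ∀ ⦃A B : C₁⦄ (φ ψ : A ⟶ B), BaseEquivalent F₁ φ ψ →
    BaseEquivalent F₂ (Ψ.functor.map φ) (Ψ.functor.map ψ))
  (hbi' : ∀ ⦃B A : C₂⦄ (α : B ⟶ A), IsPreStep F₂ α → IsIso (Base F₁ (Ψ.inverse.map α)))
  (hbe' : ∀ ⦃A B : C₂⦄ (φ ψ : A ⟶ B), BaseEquivalent F₂ φ ψ →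
    BaseEquivalent F₁ (Ψ.inverse.map φ) (Ψ.inverse.map ψ))

include hbi hbe hbi' hbe' in
/-- `Ψ^Base ⋙ (Ψ⁻¹)^Base ≅ 𝟭`: whiskering with `Base₁` reflects isomorphy (Def. 1.3 (i)(a)(b)(c),
abc-iut-L1-d6's `nonempty_iso_of_iso_whisker_base`). [cite: MochizukiFrdI2008, Thm. 3.4 (v) p.63] -/
theorem nonempty_psiBase_comp_iso_id :
    Nonempty (psiBase hF₁ Ψ.functor hbi hbe ⋙ psiBase hF₂ Ψ.inverse hbi' hbe' ≅ 𝟭 D₁) :=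
  PreFrobenioidData.nonempty_iso_of_iso_whisker_base (S₁ := PreFrobenioidData.ofFunctor Φ₁ F₁)
    (exists_base_iso_of_isFrobenioid F₁ hF₁) (exists_preSteps_of_base_iso F₁ hF₁)
    (fun A _ f => exists_arrow_over_base F₁ hF₁ A f)
    -- pasting the squares of `Ψ` and `Ψ⁻¹` with the unit: `Base₁ ⋙ (Ψ^Base ⋙ (Ψ⁻¹)^Base) ≅ Base₁ ⋙ 𝟭`
    ((Functor.associator _ _ _).symm ≪≫
      Functor.isoWhiskerRight (psiBaseSquare hF₁ Ψ.functor hbi hbe).symm _ ≪≫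
      Functor.associator _ _ _ ≪≫
      Functor.isoWhiskerLeft Ψ.functor (psiBaseSquare hF₂ Ψ.inverse hbi' hbe').symm ≪≫
      (Functor.associator _ _ _).symm ≪≫
      Functor.isoWhiskerRight Ψ.unitIso.symm _ ≪≫
      Functor.leftUnitor _ ≪≫ (Functor.rightUnitor _).symm)

include hbi hbe hbi' hbe' in
/-- `(Ψ⁻¹)^Base ⋙ Ψ^Base ≅ 𝟭`. [cite: MochizukiFrdI2008, Thm. 3.4 (v) p.63] -/
theorem nonempty_psiBase_comp_iso_id' :
    Nonempty (psiBase hF₂ Ψ.inverse hbi' hbe' ⋙ psiBase hF₁ Ψ.functor hbi hbe ≅ 𝟭 D₂) :=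
  PreFrobenioidData.nonempty_iso_of_iso_whisker_base (S₁ := PreFrobenioidData.ofFunctor Φ₂ F₂)
    (exists_base_iso_of_isFrobenioid F₂ hF₂) (exists_preSteps_of_base_iso F₂ hF₂)
    (fun A _ f => exists_arrow_over_base F₂ hF₂ A f)
    -- the mirror pasting with the counit: `Base₂ ⋙ ((Ψ⁻¹)^Base ⋙ Ψ^Base) ≅ Base₂ ⋙ 𝟭`
    ((Functor.associator _ _ _).symm ≪≫
      Functor.isoWhiskerRight (psiBaseSquare hF₂ Ψ.inverse hbi' hbe').symm _ ≪≫
      Functor.associator _ _ _ ≪≫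
      Functor.isoWhiskerLeft Ψ.inverse (psiBaseSquare hF₁ Ψ.functor hbi hbe).symm ≪≫
      (Functor.associator _ _ _).symm ≪≫
      Functor.isoWhiskerRight Ψ.counitIso _ ≪≫
      Functor.leftUnitor _ ≪≫ (Functor.rightUnitor _).symm)

include hF₂ hbi' hbe' in
/-- **`Ψ^Base` is an equivalence of categories** ([FrdI] Thm. 3.4 (v): "the horizontal arrows are
equivalences"). [cite: MochizukiFrdI2008, Thm. 3.4 (v) p.63] -/
theorem psiBase_isEquivalence : (psiBase hF₁ Ψ.functor hbi hbe).IsEquivalence := by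
  obtain ⟨η⟩ := nonempty_psiBase_comp_iso_id hF₁ hF₂ Ψ hbi hbe hbi' hbe'
  obtain ⟨ε⟩ := nonempty_psiBase_comp_iso_id' hF₁ hF₂ Ψ hbi hbe hbi' hbe'
  exact (CategoryTheory.Equivalence.mk (psiBase hF₁ Ψ.functor hbi hbe) (psiBase hF₂ Ψ.inverse hbi' hbe')
    η.symm ε).isEquivalence_functor

include hF₁ hF₂ hbi hbe hbi' hbe' in
/-- **[FrdI] Thm. 3.4 (v), the square** — the third conjunct of abc-iut-L1-t3's typed
`PreFrobenioidData.Thm34v`, from the first sentence of (v) (`hbe`, `hbe'`) and Thm. 3.4 (iii) (`hbi`, `hbi'`):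
there is `Ψ^Base : D₁ ⥤ D₂` forming a `1`-UNIQUE `1`-commutative square with `Ψ` over `Base₁`, `Base₂`
(an equivalence), and for slim `D₂` both composite functors of the square are rigid (Prop. 1.13 (i)).
[cite: MochizukiFrdI2008, Thm. 3.4 (v) p.63] -/
theorem exists_oneUniqueSquare_base (hslim₂ : IsSlim D₂) :
    ∃ ΨBase : D₁ ⥤ D₂,
      PreFrobenioidData.OneUniqueSquare Ψ.functor (PreFrobenioidData.ofFunctor Φ₁ F₁).base (PreFrobenioidData.ofFunctor Φ₂ F₂).base ΨBase ∧
        IsRigidFunctor (Ψ.functor ⋙ (PreFrobenioidData.ofFunctor Φ₂ F₂).base) ∧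
        IsRigidFunctor ((PreFrobenioidData.ofFunctor Φ₁ F₁).base ⋙ ΨBase) := by
  haveI := psiBase_isEquivalence hF₁ hF₂ Ψ hbi hbe hbi' hbe'
  have hsq : OneCommutes Ψ.functor (PreFrobenioidData.ofFunctor Φ₂ F₂).base
      (PreFrobenioidData.ofFunctor Φ₁ F₁).base (psiBase hF₁ Ψ.functor hbi hbe) :=
    ⟨psiBaseSquare hF₁ Ψ.functor hbi hbe⟩
  have hr : IsRigidFunctor (Ψ.functor ⋙ (PreFrobenioidData.ofFunctor Φ₂ F₂).base) :=
    IsRigidFunctor.comp_of_isEquivalence Ψ.functor (isRigidFunctor_baseFunctor hF₂ hslim₂)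
  refine ⟨psiBase hF₁ Ψ.functor hbi hbe,
    PreFrobenioidData.oneUniqueSquare_base_of_oneCommutes _ _ Ψ (exists_base_iso_of_isFrobenioid F₁ hF₁)
      (exists_preSteps_of_base_iso F₁ hF₁) (fun A _ f => exists_arrow_over_base F₁ hF₁ A f) _ hsq, hr, ?_⟩
  exact PreFrobenioidData.isRigidFunctor_congr (psiBaseSquare hF₁ Ψ.functor hbi hbe) hr

end PreFrobenioid

end Literature.AlgebraicGeometry.Frobenioids
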